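import Summits.QuantumFields.BalabanUV.T4Continuum.Support.AveragingDeficitDerivWallPeriodic
import Summits.QuantumFields.BalabanUV.T4Continuum.Support.AveragingDeficitPlaqDeriv

/-!
# AveragingDeficitResidualPairing (T⁴ programme, node NE3, row NE3-R2, gen 2) — THE NON-ABELIAN RESIDUAL PAIRING ON THE
# TORUS WITH β-per BY NAME: the push-forward direction `Φ = dAvg_V[ψ]` of the non-linear average (42), the first
# variation of the coarse Wilson action AT THE AVERAGED CONFIGURATION along `Φ`, and its bound
# `L^{d−4}·|⟨J(V̄), Φ⟩| ≤ wallConst·[‖∇_VF‖_{ℓ²}‖d_Vψ‖_{ℓ²} + a²(‖ψ‖_{ℓ¹} + ‖d_Vψ‖_{ℓ¹})]` at fine-critical `V`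

HONEST FRAMING (cell `pub-balaban`, T4-DAG PAGE 1; unit `b2b-balaban-t4-ne3r2-p1` = owner of BINDER-OWNERS row NE3-R2,
gen 2).  The cell's T4 target is the finite-torus continuum limit of the unit-scale averaged loop expectations — NOT
infinite volume, NO mass gap, NOT Clay, NOT summit progress.  The energy route of NE3 (`T4ConvexResponse` §4) has the
RESIDUAL PAIRING `D𝒜c(P u)[φ] = D𝓓(u)[ψ]` at fine-critical `u` whenever `dP u ψ = φ` (`residual_pairing`, linear
bookkeeping over abstract carriers) and the typed input `DefectDerivBound` (the wall).  For Bałaban's NON-LINEAR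
NON-ABELIAN one-step average `B7Prop1Explicit.bavg` (42) this file supplies the two concrete objects of that identity on
the torus and instantiates the wall BY NAME with the PROVED periodic derivative wall β-per
(`AveragingDeficitDerivWallPeriodic.deficitDerivWallPer_holds`, this unit, gen 2): §1 the coarse Wilson action as a
function of an `L`-lattice configuration (`coarseActionOf`; `coarseAction L V = coarseActionOf L (bavg L V)` by `rfl`)
and THE PUSH-FORWARD DIRECTION `pushDir L V ψ (c) := Ad_{V̄(c)⁻¹}(δV̄(c))` — the right-trivialised differential of the
average, `d/ds|₀ \overline{V e^{sψ}}(c) = V̄(c)·Φ(c)` (session 1's `AveragingDeficitSideDeriv.hasDerivAt_val_bavg_vary`: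
`= δV̄(c)·V̄(c)`), a `𝔲(N)`-valued coarse direction (`pushDir_mem_skewAdjoint`); §2 the two curves
`s ↦ \overline{V e^{sψ}}` and `s ↦ V̄ e^{sΦ}` have the same first-order jet bondwise, hence the coarse Wilson action has
the SAME derivative along both (`hasDerivAt_coarseActionOf_vary_pushDir`, `hasDerivAt_coarseAction_vary`, product rule
of session 1's `AveragingDeficitPlaqDeriv.hasDerivAt_cplaq_of_sides`): the first variation of the `L`-lattice Wilson
action AT `V̄ = bavg L V` along `Φ` — the residual current `⟨J(V̄), Φ⟩` of B11 (26)–(27) — equals the coarse half of the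
deficit derivative; §3 **`residualPairing_torus`**: for periodic small-field `V` CRITICAL for the fine Wilson action of
the period along the periodic direction `ψ`, every derivative `D_c` of `s ↦ A^{L}_{[0,M)^d}(V̄ e^{sΦ})` at `0` obeys
`L^{d−4}|D_c| ≤ wallConst d L·[√gradFluxSq·√curlSq + a²(dirL1 + curlL1)]` on the fundamental domain — R2ᴱ of the energy
route for the non-linear average with β-per BY NAME, the lift (γ: which coarse directions `φ` are of the form
`pushDir L V ψ` with `‖ψ‖ ≤ Λ‖φ‖`) being the remaining input of `T4ConvexResponse.dualResidual_le`.  NE3 ITSELF IS NOT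
PROVED (energy route: NE3(A) ⇐ ML ∧ R0 ∧ β ∧ γ; record `t4/T4-EST-NE3-P2.md` §0 (e)); NE3 stays COND-free.
CITATION HEADER: no printed sentence is a hypothesis; the manuscripts under audit are not cited for any disputed step;
context: T. Bałaban, Commun. Math. Phys. **98** (1985) 17–51 [Balaban1985Averaging] ((42) p. 23, (44) p. 24), **102**
(1985) 277–309 [Balaban1985Variational] ((5) p. 278, (26)–(27) p. 282).  PLACEMENT: `Summits/QuantumFields/BalabanUV/`
(human rule 2026-08-19).  Record: HOME `t4/T4-EST-NE3-R2.md` v0.3.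
-/

set_option autoImplicit false

open scoped BigOperators Matrix Matrix.Norms.L2Operator Topology
open NormedSpace Finset Filter

namespace Summit.QuantumFields.BalabanUV.T4Continuum.AveragingDeficitResidualPairing

open Literature.MathematicalPhysics.QuantumFieldTheory.Balaban1983to89
open B7Prop1Explicit B7Prop2Explicit MatrixLog UnitaryModel
open T4AveragingDeficitWall hiding Site Plane Plaq Bond
open T4AveragingDeficitWallBoundary (IsPeriodicCfg periodBox)
open AveragingDeficitTransport AveragingDeficitSideDeriv AveragingDeficitPlaqDeriv AveragingDeficitDerivWallProof
open AveragingDeficitPeriodicCounting AveragingDeficitDerivWallPeriodic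

noncomputable section

variable {d : ℕ} {n : Type*} [Fintype n] [DecidableEq n] [Nonempty n]

local notation "𝕄" => Matrix n n ℂ
local notation "Site" => B7Prop1Explicit.Site
local notation "Plane" => T4AveragingDeficitWall.Plane
local notation "Plaq" => T4AveragingDeficitWall.Plaq

/-! ## §1 The coarse action of an `L`-lattice configuration and the push-forward direction of the average -/

/-- The Wilson action of a window of `L`-lattice plaquettes as a function of an `L`-LATTICE CONFIGURATION `W` (bonds
`⟨Ly', Ly' + Le_κ⟩` indexed by `(Ly', κ)`): `Σ_{P ∈ W_c} (1 − Re tr W(∂P))`. [cite: Balaban1985Variational, (5) p.278] -/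
def coarseActionOf (L : ℕ) (W : Site d → Fin d → 𝕄ˣ) (Wc : Finset (Plaq d)) : ℝ :=
  ∑ P ∈ Wc, wt (cplaq L W ((L : ℤ) • P.1) P.2.1.1 P.2.1.2)

omit [Nonempty n] in
/-- `coarseAction L V = coarseActionOf L (bavg L V)`: the deficit's coarse half IS the `L`-lattice Wilson action evaluated
at the averaged configuration. [folklore] -/
theorem coarseAction_eq_coarseActionOf (L : ℕ) (V : Site d → Fin d → 𝕄ˣ) (Wc : Finset (Plaq d)) :
    coarseAction L V Wc = coarseActionOf L (bavg L V) Wc := rfl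

/-- **THE PUSH-FORWARD DIRECTION** `Φ = dAvg_V[ψ]` of the non-linear average (42) along `V e^{sψ}`, right-trivialised:
`Φ(c) := Ad_{V̄(c)⁻¹}(δV̄(c))`, so that `d/ds|₀ \overline{V e^{sψ}}(c) = V̄(c)·Φ(c)`. [cite: Balaban1985Averaging, (42) p.23] -/
def pushDir (L : ℕ) (V : Site d → Fin d → 𝕄ˣ) (ψ : Site d → Fin d → 𝕄) : Site d → Fin d → 𝕄 :=
  fun q κ => Ad (bavg L V q κ)⁻¹ (sideDeriv L V ψ q κ)

omit [Nonempty n] in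
/-- `V̄(c)·Φ(c) = δV̄(c)·V̄(c)`. [folklore] -/
theorem bavg_mul_pushDir (L : ℕ) (V : Site d → Fin d → 𝕄ˣ) (ψ : Site d → Fin d → 𝕄) (q : Site d) (κ : Fin d) :
    ((bavg L V q κ : 𝕄ˣ) : 𝕄) * pushDir L V ψ q κ = sideDeriv L V ψ q κ * ((bavg L V q κ : 𝕄ˣ) : 𝕄) := by
  simp only [pushDir, Ad, inv_inv, ← mul_assoc, Units.mul_inv, one_mul]

omit [Nonempty n] in
/-- The curve `s ↦ V̄(c) e^{sΦ(c)}` has derivative `δV̄(c)·V̄(c)` at `0` — the same first-order jet as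
`s ↦ \overline{V e^{sψ}}(c)` (`hasDerivAt_val_bavg_vary`). [folklore] -/
theorem hasDerivAt_val_vary_pushDir (L : ℕ) (V : Site d → Fin d → 𝕄ˣ) (ψ : Site d → Fin d → 𝕄) (q : Site d)
    (κ : Fin d) :
    HasDerivAt (fun s : ℝ => ((vary (bavg L V) (pushDir L V ψ) s q κ : 𝕄ˣ) : 𝕄))
      (sideDeriv L V ψ q κ * ((bavg L V q κ : 𝕄ˣ) : 𝕄)) 0 := by
  have h := (hasDerivAt_exp_smul_zero (pushDir L V ψ q κ)).const_mul ((bavg L V q κ : 𝕄ˣ) : 𝕄)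
  rw [bavg_mul_pushDir] at h
  refine h.congr_of_eventuallyEq (Filter.Eventually.of_forall fun s => ?_)
  simp only [vary, Units.val_mul, val_expUnit]

omit [Nonempty n] in
/-- `δV̄(c)` is skew-adjoint on `U(N)` data with a `𝔲(N)` direction (all loop variables of the side within `1/4` of `1`):
the log-derivative of the unitary path `s ↦ \overline{V e^{sψ}}(c)`. [folklore] -/
theorem sideDeriv_mem_skewAdjoint (L : ℕ) {V : Site d → Fin d → 𝕄ˣ} (hV : IsUnitaryCfg V) {ψ : Site d → Fin d → 𝕄}
    (hψ : IsSkewDir ψ) (q : Site d) (κ : Fin d)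
    (hW : ∀ r : Fin d → Fin L, ‖((Wcx L V q κ (boxVec L r) : 𝕄ˣ) : 𝕄) - 1‖ < 1 / 4) :
    sideDeriv L V ψ q κ ∈ skewAdjoint 𝕄 := by
  letI : CStarAlgebra 𝕄 := {}
  have hW1 : ∀ r : Fin d → Fin L, ‖((Wcx L V q κ (boxVec L r) : 𝕄ˣ) : 𝕄) - 1‖ < 1 := fun r =>
    (hW r).trans (by norm_num)
  have hd := hasDerivAt_val_bavg_vary L V ψ q κ hW1
  have hq : ∀ᶠ s in 𝓝 (0 : ℝ), ∀ r : Fin d → Fin L,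
      ‖((Wcx L (vary V ψ s) q κ (boxVec L r) : 𝕄ˣ) : 𝕄) - 1‖ ≤ 1 / 4 :=
    Filter.eventually_all.mpr fun r =>
      (eventually_norm_Wcx_vary_sub_one_lt L V ψ q κ (boxVec L r) (hW r)).mono fun s hs => hs.le
  have hu : ∀ᶠ s in 𝓝 (0 : ℝ), ((bavg L (vary V ψ s) q κ : 𝕄ˣ) : 𝕄) ∈ unitary 𝕄 := by
    refine hq.mono fun s hs => ?_
    have hVs := vary_isUnitaryCfg hV hψ s
    have hb : bavg L (vary V ψ s) q κ ∈ unitaryUnits 𝕄 := bavg_mem_unitaryUnits hVs L q κ hs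
    exact mem_unitaryUnits.mp hb
  have hskew := mem_skewAdjoint_of_unitary_path hd hu
  have hC : ((bavg L (vary V ψ 0) q κ : 𝕄ˣ) : 𝕄) ∈ unitary 𝕄 := hu.self_of_nhds
  simp only [vary_zero] at hC hskew
  rwa [mul_assoc, Unitary.mul_star_self_of_mem hC, mul_one] at hskew

omit [Nonempty n] in
/-- **`Φ(c) ∈ 𝔲(N)`**: the push-forward of a `𝔲(N)` direction at `U(N)` data is a `𝔲(N)`-valued coarse direction.
[folklore] -/
theorem pushDir_mem_skewAdjoint (L : ℕ) {V : Site d → Fin d → 𝕄ˣ} (hV : IsUnitaryCfg V) {ψ : Site d → Fin d → 𝕄}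
    (hψ : IsSkewDir ψ) (q : Site d) (κ : Fin d)
    (hW : ∀ r : Fin d → Fin L, ‖((Wcx L V q κ (boxVec L r) : 𝕄ˣ) : 𝕄) - 1‖ < 1 / 4) :
    pushDir L V ψ q κ ∈ skewAdjoint 𝕄 := by
  letI : CStarAlgebra 𝕄 := {}
  have hb : bavg L V q κ ∈ unitaryUnits 𝕄 := bavg_mem_unitaryUnits hV L q κ fun r => (hW r).le
  have hs : sideDeriv L V ψ q κ ∈ skewAdjoint 𝕄 := sideDeriv_mem_skewAdjoint L hV hψ q κ hW
  unfold pushDir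
  exact Ad_mem_skewAdjoint (inv_mem hb) hs

/-! ## §2 The first variation of the coarse action at `V̄` along `Φ` equals the coarse half of the deficit derivative -/

omit [Nonempty n] in
/-- **THE FIRST VARIATION OF THE `L`-LATTICE WILSON ACTION AT THE AVERAGED CONFIGURATION ALONG `Φ`**:
`d/ds|₀ A^L_{W_c}(V̄ e^{sΦ}) = −Σ_{P∈W_c} Re tr(Ω_P · V̄(∂P))`, `Ω_P = plaqOmega` (session 1's product rule with the sides'
common jet). [cite: Balaban1985Variational, (5) p.278, (26)–(27) p.282] -/
theorem hasDerivAt_coarseActionOf_vary_pushDir (L : ℕ) (V : Site d → Fin d → 𝕄ˣ) (ψ : Site d → Fin d → 𝕄)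
    (Wc : Finset (Plaq d)) :
    HasDerivAt (fun s : ℝ => coarseActionOf L (vary (bavg L V) (pushDir L V ψ) s) Wc)
      (∑ P ∈ Wc, -nReTr (plaqOmega L V ψ ((L : ℤ) • P.1) P.2.1.1 P.2.1.2 * ((chol L V P : 𝕄ˣ) : 𝕄))) 0 := by
  refine HasDerivAt.fun_sum (u := Wc) fun P _ => ?_
  have h := hasDerivAt_cplaq_of_sides L (fun s => vary (bavg L V) (pushDir L V ψ) s) ((L : ℤ) • P.1) P.2.1.1 P.2.1.2
    (δ₁ := sideDeriv L V ψ ((L : ℤ) • P.1) P.2.1.1)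
    (δ₂ := sideDeriv L V ψ ((L : ℤ) • P.1 + (L : ℤ) • e P.2.1.1) P.2.1.2)
    (δ₃ := sideDeriv L V ψ ((L : ℤ) • P.1 + (L : ℤ) • e P.2.1.2) P.2.1.1) (δ₄ := sideDeriv L V ψ ((L : ℤ) • P.1) P.2.1.2)
    (by simpa only [vary_zero] using hasDerivAt_val_vary_pushDir L V ψ ((L : ℤ) • P.1) P.2.1.1)
    (by simpa only [vary_zero] using hasDerivAt_val_vary_pushDir L V ψ _ P.2.1.2)
    (by simpa only [vary_zero] using hasDerivAt_val_vary_pushDir L V ψ _ P.2.1.1)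
    (by simpa only [vary_zero] using hasDerivAt_val_vary_pushDir L V ψ ((L : ℤ) • P.1) P.2.1.2)
  simp only [vary_zero] at h
  have h' := ((nReTrL (n := n)).hasFDerivAt.comp_hasDerivAt (0 : ℝ) h).const_sub 1
  simpa [wt, chol, plaqOmega, Function.comp_def] using h'

omit [Nonempty n] in
/-- **THE COARSE HALF OF THE DEFICIT DERIVATIVE** is the same number: `d/ds|₀ A^L_{W_c}(\overline{V e^{sψ}}) =
−Σ_{P∈W_c} Re tr(Ω_P · V̄(∂P))` (inside the ball of (21)). [cite: Balaban1985Averaging, (42) p.23, (44) p.24] -/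
theorem hasDerivAt_coarseAction_vary (L : ℕ) (V : Site d → Fin d → 𝕄ˣ) (ψ : Site d → Fin d → 𝕄)
    (Wc : Finset (Plaq d))
    (hW : ∀ (q : Site d) (κ : Fin d) (r : Fin d → Fin L), ‖((Wcx L V q κ (boxVec L r) : 𝕄ˣ) : 𝕄) - 1‖ < 1) :
    HasDerivAt (fun s : ℝ => coarseAction L (vary V ψ s) Wc)
      (∑ P ∈ Wc, -nReTr (plaqOmega L V ψ ((L : ℤ) • P.1) P.2.1.1 P.2.1.2 * ((chol L V P : 𝕄ˣ) : 𝕄))) 0 := by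
  refine HasDerivAt.fun_sum (u := Wc) fun P _ => ?_
  exact hasDerivAt_wt_chol_vary L V ψ P.1 P.2 hW

omit [Nonempty n] in
/-- **RESIDUAL PAIRING, IDENTITY LEVEL**: every derivative of the coarse action of `\overline{V e^{sψ}}` at `0` is a
derivative of the `L`-lattice Wilson action at `V̄` along `Φ = pushDir L V ψ`, and conversely (both curves have the same
bondwise jet). [folklore] -/
theorem hasDerivAt_coarseAction_iff_pushDir (L : ℕ) (V : Site d → Fin d → 𝕄ˣ) (ψ : Site d → Fin d → 𝕄)
    (Wc : Finset (Plaq d))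
    (hW : ∀ (q : Site d) (κ : Fin d) (r : Fin d → Fin L), ‖((Wcx L V q κ (boxVec L r) : 𝕄ˣ) : 𝕄) - 1‖ < 1) (Dc : ℝ) :
    HasDerivAt (fun s : ℝ => coarseAction L (vary V ψ s) Wc) Dc 0
      ↔ HasDerivAt (fun s : ℝ => coarseActionOf L (vary (bavg L V) (pushDir L V ψ) s) Wc) Dc 0 := by
  have h1 := hasDerivAt_coarseAction_vary L V ψ Wc hW
  have h2 := hasDerivAt_coarseActionOf_vary_pushDir L V ψ Wc
  constructor
  · intro h
    have e := h.unique h1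
    subst e
    exact h2
  · intro h
    have e := h.unique h2
    subst e
    exact h1

/-! ## §3 R2ᴱ for the non-linear average on the torus: the residual pairing with β-per BY NAME -/

/-- **THE RESIDUAL PAIRING ON THE TORUS WITH β-per BY NAME** (R2ᴱ of the NE3 energy route for Bałaban's non-linear
non-abelian average, modulo the lift γ): for every `M ≥ 1`, every `U(N)`-valued `V` of period `L·M` in the small-field
class (`a ≤ 1/(512(d+1)(d+4)L²)`), every `𝔲(N)`-valued direction `ψ` of period `L·M` along which `V` is CRITICAL for
the fine Wilson action of the period, and every derivative `D_c` at `0` of the `L`-lattice Wilson action of the period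
AT THE AVERAGED CONFIGURATION along the push-forward direction `Φ = pushDir L V ψ`, `s ↦ A^L_{[0,M)^d}(V̄ e^{sΦ})`:
`L^{d−4}·|D_c| ≤ wallConst d L·[‖∇_VF‖_{ℓ²}‖d_Vψ‖_{ℓ²} + a²(‖ψ‖_{ℓ¹} + ‖d_Vψ‖_{ℓ¹})]` on `[0,LM)^d`.  Dictionary:
`V = U_{k+1}(V′)`, `V̄ = W_k(V′)`, `D_c = ⟨J(W_k(V′)), Φ⟩` [cite: Balaban1985Variational, (26)–(27) p.282]. [folklore] -/
theorem residualPairing_torus (L : ℕ) (hL : 1 ≤ L) {M : ℕ} (hM : 1 ≤ M) {V : Site d → Fin d → 𝕄ˣ}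
    (hV : IsUnitaryCfg V) (hVP : IsPeriodicCfg V ((L : ℤ) * M)) {a : ℝ} (ha : 0 ≤ a)
    (haa₀ : a ≤ 1 / (512 * (d + 1) * (d + 4) * (L : ℝ) ^ 2)) (hVa : SmallField V a) {ψ : Site d → Fin d → 𝕄}
    (hψ : IsSkewDir ψ) (hψP : IsPeriodicDir ψ ((L : ℤ) * M))
    (hcrit : HasDerivAt (fun s : ℝ => fineAction (vary V ψ s) (blockWindow L (periodBox M)).2) 0 0) {Dc : ℝ}
    (hDc : HasDerivAt
      (fun s : ℝ => coarseActionOf L (vary (bavg L V) (pushDir L V ψ) s) (blockWindow L (periodBox M)).1) Dc 0) :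
    (L : ℝ) ^ ((d : ℤ) - 4) * |Dc|
      ≤ wallConst d L * (Real.sqrt (gradFluxSq V (blockSites L (periodBox M)))
          * Real.sqrt (curlSq V ψ (blockSites L (periodBox M)))
        + a ^ 2 * (dirL1 ψ (blockSites L (periodBox M)) + curlL1 V ψ (blockSites L (periodBox M)))) := by
  have hK : (0 : ℝ) ≤ 512 * (d + 1) * (d + 4) * (L : ℝ) ^ 2 := by positivity
  have hKpos : (0 : ℝ) < 512 * (d + 1) * (d + 4) * (L : ℝ) ^ 2 := by
    have hL0 : (0 : ℝ) < L := by exact_mod_cast hL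
    positivity
  have hsmall : 512 * (d + 1) * (d + 4) * (L : ℝ) ^ 2 * a ≤ 1 :=
    (mul_le_mul_of_nonneg_left haa₀ hK).trans (le_of_eq (mul_one_div_cancel hKpos.ne'))
  have hW : ∀ (q : Site d) (κ : Fin d) (r : Fin d → Fin L), ‖((Wcx L V q κ (boxVec L r) : 𝕄ˣ) : 𝕄) - 1‖ < 1 :=
    norm_Wcx_sub_one_lt_one_of_smallField L hL hV ha hsmall hVa
  exact coarseDeriv_abs_le_of_fineCritical L hL hM hV hVP ha haa₀ hVa hψ hψP hcrit
    ((hasDerivAt_coarseAction_iff_pushDir L V ψ _ hW Dc).mpr hDc)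

end

end Summit.QuantumFields.BalabanUV.T4Continuum.AveragingDeficitResidualPairing
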